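import Summits.AtomisticToContinuum.HydrodynamicLimit.Theses.OneFlightGossipEngine
import Summits.AtomisticToContinuum.HydrodynamicLimit.Theses.AntiMazurCoboundaries
import Literature.Analysis.FluidPDE.LocalForecastCorrector

/-!
# Crux-ideate sketch — `BandCoherenceLDAlongFamilies` (stmt-AtomisticToContinuum-17700), ideator 1, round 1

First lemmas of the three idea cards, TYPED over existing declarations (nothing proved here; every
`def … : Prop` is a statement to be proved or consumed by a line).

* §1 `StaticCeilingConst` — card `time-jensen-static-ceiling`: the crux inequality at CONSTANT families holds,
  with NO dynamics, for every `ε ≥ 5·exp(−3K⋆²/(16Θ̄))` (Jensen in time + flow-invariance of the homogeneous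
  local Gibbs law `map_flow_localGibbsLaw_const` + conditional Maxwellian independence).
* §2 `GalileanSoftFloor`, `bandResponse`, `BandCurrentOrthogonal`, `BandCurrentLDQuantTilt` — card
  `mazur-shifted-band-current`: the soft-mode (Galilean) floor that kills the decl as typed, the Maxwellian
  momentum response `g₁` of a band weight, the Mazur-shifted odd band current and its three orthogonality
  relations (provable now), and the quantitative-tilt kinetic-current LD that replaces the coherence functional.
* §3 `LocalisationSplit` — card `forecast-localised-gibbs-pressure`: Hölder split of the window pressure into the
  pressure of the R-ball FORECAST functional (a local function of the initial Gibbs field) and the exponential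
  moment of the number of badly-forecast particles (`AntiMazurCoboundaries.InfluenceLocality`, stmt-13916).
-/

noncomputable section

namespace Summit.AtomisticToContinuum.HydrodynamicLimit.Cruxes.BandCoherenceLDAlongFamilies.IdeatorOne

open scoped BigOperators ENNReal Classical
open MeasureTheory Set Filter
open Literature.MathematicalPhysics.KineticTheory Literature.Analysis.FluidPDE

/-! ## §1 The dynamics-free static ceiling (card `time-jensen-static-ceiling`) -/

/-- **Static ceiling at constant families.** For the homogeneous reference law (constant `a₀, θ₀`, zero drift) the
band-coherence exponential moment of the crux is at most `exp(5 e^{−3K⋆²/(16Θ̄)} (N+1))` for EVERY `τ, N, η, R`: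
`S ≤ Σ_i cubBand_i ≤ (8Θ̄K₁) w⁻¹∫₀ʷ Ψ(z(r)) dr` with the ONE-TIME function `Ψ(z) = Σ_i ‖v_i‖² 1{‖v_i‖ > K⋆}/(8Θ̄)`
(band tilt `≤` Gaussian, `band_tilt_le_gaussian`), Jensen in `r`, Tonelli, invariance of the law under `Φ_r`
(`map_flow_localGibbsLaw_const`) and the i.i.d. Maxwellian velocities give `(1 + γ)^{N+1}`,
`γ = E[e^{‖v‖²/(8Θ̄)}; ‖v‖ > K⋆] ≤ (8/3)^{3/2} e^{−3K⋆²/(16 θ₀)} ≤ 5 e^{−3K⋆²/(16Θ̄)}`. -/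
def StaticCeilingConst : Prop :=
  ∀ (a₀ θ₀ Θbar : ℝ), 0 < a₀ → 0 < θ₀ → θ₀ ≤ Θbar → ∀ σ : ℝ, 0 < σ → σ < 1 / 2 →
    ∀ Φ : (N : ℕ) → HardSphereFlow (Torus.geometry (Fin 3)) (hsDiameter σ N) (N + 1),
    ∀ Kstar K₁ : ℝ, 0 < Kstar → Kstar ≤ K₁ →
    ∀ R : ℝ → T3 → ℝ → ℝ, Measurable (fun p : ℝ × T3 × ℝ => R p.1 p.2.1 p.2.2) →
      (∀ s x s', s' ≤ Kstar ^ 2 → R s x s' = 0) → (∀ s x s', |R s x s'| ≤ |s'|) →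
    ∀ η : ℝ, 0 < η → ∀ τ : ℝ, 0 < τ → ∀ (N : ℕ) (s : ℝ),
      (let w : ℝ := τ * ((N : ℝ) + 1) ^ (-(1 / 3 : ℝ))
       let P := localGibbsLaw σ (fun _ => a₀) (fun _ => (0 : V3)) (fun _ => θ₀) N (Φ N)
       let W := fun (i : Fin (N + 1)) (r : ℝ) (z : Config (N + 1) (Fin 3) T3) => ((Φ N).flow r z i).2
       let cub := fun (i : Fin (N + 1)) z => w⁻¹ * ∫ r in (0 : ℝ)..w, ‖W i r z‖ ^ 3
       let cubBand := fun (i : Fin (N + 1)) z =>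
         w⁻¹ * ∫ r in (0 : ℝ)..w, (if Kstar < ‖W i r z‖ ∧ ‖W i r z‖ ≤ K₁ then ‖W i r z‖ ^ 3 else 0)
       let qbar := fun (i : Fin (N + 1)) z =>
         w⁻¹ • ∫ r in (0 : ℝ)..w, (R s ((Φ N).flow r z i).1 (‖W i r z‖ ^ 2)) • W i r z
       ∫⁻ z, ENNReal.ofReal (Real.exp ((8 * Θbar * K₁)⁻¹ *
           ∑ i : Fin (N + 1), (if η * cub i z < ‖qbar i z‖ then cubBand i z else 0))) ∂P
         ≤ ENNReal.ofReal (Real.exp (5 * Real.exp (-(3 * Kstar ^ 2 / (16 * Θbar))) * ((N : ℝ) + 1))))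

/-- **Static ceiling along families (isothermal first).** The same bound with an `ε`-slack absorbing the window
quasi-invariance of the local Gibbs law over `[0, w]` (Rényi form of the KCWF line's `WindowRenyiIsothermal`;
the thermal-gradient case shares that line's open high-momentum sub-problem). Quantifiers of the crux with
`∀ τ > 0 ∀ ε > 0 ∃ N₀` (no `τ → ∞` needed). -/
def StaticCeilingAlongFamilies : Prop :=
  ∃ η₀ : ℝ, 0 < η₀ ∧ ∀ (t₁ Θbar : ℝ) (a θ₀ : ℝ → T3 → ℝ) (u₀ : ℝ → T3 → V3),
    Continuous (Function.uncurry a) → Continuous (Function.uncurry θ₀) → Continuous (Function.uncurry u₀) →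
    (∀ s x, 0 < a s x) → (∀ s x, 0 < θ₀ s x) → (∀ s ∈ Set.Icc 0 t₁, ∀ x, θ₀ s x ≤ Θbar) →
    ∀ σ : ℝ, 0 < σ → (∀ s ∈ Set.Icc 0 t₁, σ ^ 3 * (⨆ x, a s x) ≤ η₀ * ∫ x, a s x) →
    ∀ Φ : (N : ℕ) → HardSphereFlow (Torus.geometry (Fin 3)) (hsDiameter σ N) (N + 1),
    ∀ Kstar K₁ : ℝ, 0 < Kstar → Kstar ≤ K₁ →
    ∀ R : ℝ → T3 → ℝ → ℝ, Measurable (fun p : ℝ × T3 × ℝ => R p.1 p.2.1 p.2.2) →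
      (∀ s x s', s' ≤ Kstar ^ 2 → R s x s' = 0) → (∀ s x s', |R s x s'| ≤ |s'|) →
    ∀ η : ℝ, 0 < η → ∀ τ : ℝ, 0 < τ → ∀ ε : ℝ, 0 < ε → ∃ N₀ : ℕ, ∀ N : ℕ, N₀ ≤ N → ∀ s ∈ Set.Icc 0 t₁,
      (let w : ℝ := τ * ((N : ℝ) + 1) ^ (-(1 / 3 : ℝ))
       let P := localGibbsLaw σ (a s) (u₀ s) (θ₀ s) N (Φ N)
       let W := fun (i : Fin (N + 1)) (r : ℝ) (z : Config (N + 1) (Fin 3) T3) =>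
         ((Φ N).flow r z i).2 - u₀ s ((Φ N).flow r z i).1
       let cub := fun (i : Fin (N + 1)) z => w⁻¹ * ∫ r in (0 : ℝ)..w, ‖W i r z‖ ^ 3
       let cubBand := fun (i : Fin (N + 1)) z =>
         w⁻¹ * ∫ r in (0 : ℝ)..w, (if Kstar < ‖W i r z‖ ∧ ‖W i r z‖ ≤ K₁ then ‖W i r z‖ ^ 3 else 0)
       let qbar := fun (i : Fin (N + 1)) z =>
         w⁻¹ • ∫ r in (0 : ℝ)..w, (R s ((Φ N).flow r z i).1 (‖W i r z‖ ^ 2)) • W i r z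
       ∫⁻ z, ENNReal.ofReal (Real.exp ((8 * Θbar * K₁)⁻¹ *
           ∑ i : Fin (N + 1), (if η * cub i z < ‖qbar i z‖ then cubBand i z else 0))) ∂P
         ≤ ENNReal.ofReal (Real.exp ((5 * Real.exp (-(3 * Kstar ^ 2 / (16 * Θbar))) + ε) * ((N : ℝ) + 1))))

/-! ## §2 Soft modes: the Galilean floor, the Maxwellian momentum response, the Mazur-shifted band current
(card `mazur-shifted-band-current`) -/

/-- The unit vector `e₀` of `V3`. -/
def e0 : V3 := EuclideanSpace.single (0 : Fin 3) (1 : ℝ)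

/-- The **band weight of the witness**: `R⋆(s′) = (s′ − K⋆²)·1{K⋆² < s′ ≤ K₁²}` (vanishes below `K⋆²`,
`|R⋆| ≤ |s′|`, and `‖R⋆(‖W‖²)W‖ ≤ 1{K⋆ < ‖W‖ ≤ K₁}‖W‖³`, so `‖q̄_i‖ ≤ cubBand_i` pathwise). -/
def Rstar (Kstar K₁ : ℝ) (s' : ℝ) : ℝ := if Kstar ^ 2 < s' ∧ s' ≤ K₁ ^ 2 then s' - Kstar ^ 2 else 0

/-- **Linear Galilean response of a radial band weight** under the Maxwellian of temperature `θ` boosted by `D e₀`: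
`γ_R(θ, D) = ∫ R(‖v‖²) v₀ M_{1,θ,De₀}(v) dv` (odd in `D`, `= D·g₁ + O(D³)`). -/
def driftResponse (R : ℝ → ℝ) (θ D : ℝ) : ℝ :=
  ∫ v : V3, R (‖v‖ ^ 2) * v 0 * localMaxwellian 1 θ (D • e0) v

/-- Third absolute moment of the boosted Maxwellian, `C₃(θ, D) = ∫ ‖v‖³ M_{1,θ,De₀}(v) dv`. -/
def cubicMoment (θ D : ℝ) : ℝ :=
  ∫ v : V3, ‖v‖ ^ 3 * localMaxwellian 1 θ (D • e0) v

/-- **The Galilean soft-mode floor (LD-scale Mazur bound).** At CONSTANT families (zero drift) and the band weight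
`R⋆`, for every boost `D`, every `η, τ, N`: `(N+1)·[λ(γ_{R⋆}(θ₀,D) − η C₃(θ₀,D)) − D²/(2θ₀)] ≤ log ∫ exp(λ S) dG`,
`λ = (8Θ̄K₁)⁻¹` — entropy inequality `log E_P e^F ≥ E_Q F − H(Q‖P)` with `Q` = the boosted homogeneous law
(flow-invariant: `map_flow_localGibbsLaw_const`, `H(Q‖P) = (N+1)D²/(2θ₀)` by `localGibbsLaw_const_map_velShift`),
`S_i ≥ q̄_i·e₀ − η cub_i` pathwise and Tonelli + stationarity. Linear gain against quadratic cost: the right side is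
`≥ c(η)·(N+1)` with `c(η) > 0` for `η < λ g₁² θ₀/(2C₃)`, which is why the decl as typed (`∀ η ∀ ε`) is false
(refuter rattack-17700, WITNESS.md) and what any repaired decl must budget. -/
def GalileanSoftFloor : Prop :=
  ∀ (a₀ θ₀ Θbar : ℝ), 0 < a₀ → 0 < θ₀ → θ₀ ≤ Θbar → ∀ σ : ℝ, 0 < σ → σ < 1 / 2 →
    ∀ Φ : (N : ℕ) → HardSphereFlow (Torus.geometry (Fin 3)) (hsDiameter σ N) (N + 1),
    ∀ Kstar K₁ : ℝ, 0 < Kstar → Kstar ≤ K₁ → ∀ (D η τ : ℝ), 0 < η → 0 < τ → ∀ N : ℕ,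
      (let w : ℝ := τ * ((N : ℝ) + 1) ^ (-(1 / 3 : ℝ))
       let P := localGibbsLaw σ (fun _ => a₀) (fun _ => (0 : V3)) (fun _ => θ₀) N (Φ N)
       let W := fun (i : Fin (N + 1)) (r : ℝ) (z : Config (N + 1) (Fin 3) T3) => ((Φ N).flow r z i).2
       let cub := fun (i : Fin (N + 1)) z => w⁻¹ * ∫ r in (0 : ℝ)..w, ‖W i r z‖ ^ 3
       let cubBand := fun (i : Fin (N + 1)) z =>
         w⁻¹ * ∫ r in (0 : ℝ)..w, (if Kstar < ‖W i r z‖ ∧ ‖W i r z‖ ≤ K₁ then ‖W i r z‖ ^ 3 else 0)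
       let qbar := fun (i : Fin (N + 1)) z =>
         w⁻¹ • ∫ r in (0 : ℝ)..w, (Rstar Kstar K₁ (‖W i r z‖ ^ 2)) • W i r z
       ENNReal.ofReal (Real.exp (((N : ℝ) + 1) *
           ((8 * Θbar * K₁)⁻¹ * (driftResponse (Rstar Kstar K₁) θ₀ D - η * cubicMoment θ₀ D)
             - D ^ 2 / (2 * θ₀))))
         ≤ ∫⁻ z, ENNReal.ofReal (Real.exp ((8 * Θbar * K₁)⁻¹ *
             ∑ i : Fin (N + 1), (if η * cub i z < ‖qbar i z‖ then cubBand i z else 0))) ∂P)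

/-- **Maxwellian momentum response of a radial weight** (the Mazur shift coefficient):
`g₁(θ, R) = θ⁻¹ ∫ R(‖v‖²) v₀² M_{1,θ,0}(v) dv = ∂_D γ_R(θ, D)|_{D=0}`. For the FULL heat-flux weight
`R(s′) = (s′ − 5θ)/2` it vanishes (Galilean orthogonality of the heat flux); for a band-restricted weight it
does not — the source of the soft-mode floor. -/
def bandResponse (R : ℝ → ℝ) (θ : ℝ) : ℝ :=
  θ⁻¹ * ∫ v : V3, R (‖v‖ ^ 2) * (v 0) ^ 2 * localMaxwellian 1 θ 0 v

/-- **The Mazur-shifted band current is a kinetic current of the KCWF class**: for every temperature `θ > 0`, drift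
`u`, weight vector `b` and measurable radial `R` with `|R(s′)| ≤ |s′|`, the odd functional
`F(v) = (b·w)(R(‖w‖²) − g₁(θ,R))`, `w = v − u`, is orthogonal to `1`, `v_j` (`j = 0,1,2`) and `‖v‖²` under
`M_{1,θ,u}` (oddness for `1` and `‖w‖²`-even parts; the choice of `g₁` for `v_j`; isotropy of the Maxwellian).
Provable now (Gaussian symmetry + polar integration); the first lemma of the repair line. -/
def BandCurrentOrthogonal : Prop :=
  ∀ (θ : ℝ), 0 < θ → ∀ (u b : V3) (R : ℝ → ℝ), Measurable R → (∀ s', |R s'| ≤ |s'|) →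
    (let F : V3 → ℝ := fun v => (∑ l : Fin 3, b l * (v - u) l) * (R (‖v - u‖ ^ 2) - bandResponse R θ)
     (∫ v, F v * localMaxwellian 1 θ u v = 0) ∧
     (∀ j : Fin 3, ∫ v, F v * v j * localMaxwellian 1 θ u v = 0) ∧
     (∫ v, F v * ‖v‖ ^ 2 * localMaxwellian 1 θ u v = 0))

/-- **Candidate repaired decl (for the tenure / repair planner, NOT the crux): quantitative-tilt window LD of the
Mazur-shifted band current along families.** KCWF's frame (`KineticCurrentsLDAlongFamilies`, stmt-16659) for the
single functional `F_s(x,v) = (b_s(x)·w)(R(s,x,‖w‖²) − g₁(θ_s(x), R(s,x,·)))`, `w = v − u_s(x)`, with the band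
conditions on `R` (`R = 0` below `K⋆²`, `|R| ≤ |s′|`, `R = 0` above `K₁²`) and a bound `‖b_s(x)‖ ≤ B`, at the
EXPLICIT tilt `β = ±(8Θ̄K₁B)⁻¹` instead of KCWF's black-box `∃ β₀`: `∀ ε ∃ τ₀ ∀ τ ≥ τ₀ ∃ N₀ ∀ N ≥ N₀ ∀ s`,
`∫ exp(β Σ_i w⁻¹∫₀ʷ F_s(z_i(r)) dr) dλ_s^N ≤ e^{ε(N+1)}`. No coherence indicator, no `η`; the Galilean floor is
zero for it (odd + `⊥ v`), second-order soft responses are beaten by `band_tilt_le_gaussian` once `K⋆` is large,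
and in the dock the complementary linear term `g₁ Σ_i b·w̄_i` is an energy-bounded SOURCE. -/
def BandCurrentLDQuantTilt : Prop :=
  ∃ η₀ : ℝ, 0 < η₀ ∧ ∀ (t₁ Θbar B : ℝ) (a θ₀ : ℝ → T3 → ℝ) (u₀ : ℝ → T3 → V3) (b : ℝ → T3 → V3),
    Continuous (Function.uncurry a) → Continuous (Function.uncurry θ₀) → Continuous (Function.uncurry u₀) →
    Continuous (Function.uncurry b) →
    (∀ s x, 0 < a s x) → (∀ s x, 0 < θ₀ s x) → (∀ s ∈ Set.Icc 0 t₁, ∀ x, θ₀ s x ≤ Θbar) →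
    (∀ s ∈ Set.Icc 0 t₁, ∀ x, ‖b s x‖ ≤ B) → 0 < B →
    ∀ σ : ℝ, 0 < σ → (∀ s ∈ Set.Icc 0 t₁, σ ^ 3 * (⨆ x, a s x) ≤ η₀ * ∫ x, a s x) →
    ∀ Φ : (N : ℕ) → HardSphereFlow (Torus.geometry (Fin 3)) (hsDiameter σ N) (N + 1),
    ∀ Kstar K₁ : ℝ, 0 < Kstar → Kstar ≤ K₁ →
    ∀ R : ℝ → T3 → ℝ → ℝ, Measurable (fun p : ℝ × T3 × ℝ => R p.1 p.2.1 p.2.2) →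
      (∀ s x s', s' ≤ Kstar ^ 2 → R s x s' = 0) → (∀ s x s', K₁ ^ 2 < s' → R s x s' = 0) →
      (∀ s x s', |R s x s'| ≤ |s'|) →
    ∀ ε : ℝ, 0 < ε → ∃ τ₀ : ℝ, 0 < τ₀ ∧ ∀ τ : ℝ, τ₀ ≤ τ → ∃ N₀ : ℕ, ∀ N : ℕ, N₀ ≤ N → ∀ s ∈ Set.Icc 0 t₁,
      (let w : ℝ := τ * ((N : ℝ) + 1) ^ (-(1 / 3 : ℝ))
       let P := localGibbsLaw σ (a s) (u₀ s) (θ₀ s) N (Φ N)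
       let F : T3 × V3 → ℝ := fun y =>
         (∑ l : Fin 3, b s y.1 l * (y.2 - u₀ s y.1) l) *
           (R s y.1 (‖y.2 - u₀ s y.1‖ ^ 2) - bandResponse (R s y.1) (θ₀ s y.1))
       ∀ β : ℝ, |β| ≤ (8 * Θbar * K₁ * B)⁻¹ →
         ∫⁻ z, ENNReal.ofReal (Real.exp (β * ∑ i : Fin (N + 1),
             w⁻¹ * ∫ r in (0 : ℝ)..w, F ((Φ N).flow r z i))) ∂P
           ≤ ENNReal.ofReal (Real.exp (ε * ((N : ℝ) + 1))))

/-! ## §3 Localisation by forecasts (card `forecast-localised-gibbs-pressure`) -/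

/-- **Localisation split (provable now: pointwise `S ≤ S^loc + K₁³·#bad` and Hölder).** At constant families, for
every family of cluster flows `Ψ`, range `Rloc`, and Hölder exponent `p > 1`: the crux's window pressure is bounded
by `p⁻¹ ×` the pressure at tilt `pλ` of the same functional computed along the LOCAL CLUSTER STATES
(`localClusterState Ψ (Rloc (N+1)^{-1/3})`, a function of the initial data in the `Rloc`-ball only) plus
`(1 − p⁻¹) ×` the exponential moment of `p′λK₁³ · #{i badly forecast on [0,w]}` — the latter is exactly the
currency of `AntiMazurCoboundaries.InfluenceLocality` (stmt-13916, horizon `T = τ`). -/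
def LocalisationSplit : Prop :=
  ∀ (a₀ θ₀ Θbar : ℝ), 0 < a₀ → 0 < θ₀ → θ₀ ≤ Θbar → ∀ σ : ℝ, 0 < σ → σ < 1 / 2 →
    ∀ Φ : (N : ℕ) → HardSphereFlow (Torus.geometry (Fin 3)) (hsDiameter σ N) (N + 1),
    ∀ Ψ : (N : ℕ) → (k : ℕ) → HardSphereFlow (Torus.geometry (Fin 3)) (hsDiameter σ N) k,
    ∀ Kstar K₁ : ℝ, 0 < Kstar → Kstar ≤ K₁ →
    ∀ R : ℝ → T3 → ℝ → ℝ, Measurable (fun p : ℝ × T3 × ℝ => R p.1 p.2.1 p.2.2) →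
      (∀ s x s', s' ≤ Kstar ^ 2 → R s x s' = 0) → (∀ s x s', |R s x s'| ≤ |s'|) →
    ∀ (η τ Rloc p : ℝ), 0 < η → 0 < τ → 0 < Rloc → 1 < p → ∀ (N : ℕ) (s : ℝ),
      (let w : ℝ := τ * ((N : ℝ) + 1) ^ (-(1 / 3 : ℝ))
       let ρ : ℝ := Rloc * ((N : ℝ) + 1) ^ (-(1 / 3 : ℝ))
       let P := localGibbsLaw σ (fun _ => a₀) (fun _ => (0 : V3)) (fun _ => θ₀) N (Φ N)
       -- the true orbit of particle `i` and its local forecast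
       let orb := fun (i : Fin (N + 1)) (r : ℝ) (z : Config (N + 1) (Fin 3) T3) => (Φ N).flow r z i
       let loc := fun (i : Fin (N + 1)) (r : ℝ) (z : Config (N + 1) (Fin 3) T3) =>
         localClusterState (Ψ N) ρ r z i
       -- the band-coherence summand along an arbitrary one-particle path `γ`
       let X := fun (γ : ℝ → T3 × V3) =>
         (let cub := w⁻¹ * ∫ r in (0 : ℝ)..w, ‖(γ r).2‖ ^ 3
          let cubBand := w⁻¹ * ∫ r in (0 : ℝ)..w,
            (if Kstar < ‖(γ r).2‖ ∧ ‖(γ r).2‖ ≤ K₁ then ‖(γ r).2‖ ^ 3 else 0)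
          let qbar : V3 := w⁻¹ • ∫ r in (0 : ℝ)..w, (R s (γ r).1 (‖(γ r).2‖ ^ 2)) • (γ r).2
          if η * cub < ‖qbar‖ then cubBand else 0)
       let bad := fun (z : Config (N + 1) (Fin 3) T3) =>
         ((Finset.univ.filter fun i : Fin (N + 1) => ∃ r ∈ Set.Icc (0 : ℝ) w, orb i r z ≠ loc i r z).card : ℝ)
       ∫⁻ z, ENNReal.ofReal (Real.exp ((8 * Θbar * K₁)⁻¹ * ∑ i : Fin (N + 1), X (fun r => orb i r z))) ∂P
         ≤ (∫⁻ z, ENNReal.ofReal (Real.exp (p * (8 * Θbar * K₁)⁻¹ *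
               ∑ i : Fin (N + 1), X (fun r => loc i r z))) ∂P) ^ (p⁻¹ : ℝ) *
           (∫⁻ z, ENNReal.ofReal (Real.exp ((p / (p - 1)) * (8 * Θbar * K₁)⁻¹ * K₁ ^ 3 * bad z)) ∂P)
             ^ (1 - p⁻¹ : ℝ))

/-- Sanity: the crux decl and the shared influence-locality crux are the constants this sketch refers to. -/
example : Prop := Summit.AtomisticToContinuum.HydrodynamicLimit.Theses.OneFlightGossipEngine.BandCoherenceLDAlongFamilies
example : Prop := Summit.AtomisticToContinuum.HydrodynamicLimit.Theses.AntiMazurCoboundaries.InfluenceLocality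
example : Prop := Summit.AtomisticToContinuum.HydrodynamicLimit.Theses.OneFlightGossipEngine.KineticCurrentsLDAlongFamilies

end Summit.AtomisticToContinuum.HydrodynamicLimit.Cruxes.BandCoherenceLDAlongFamilies.IdeatorOne

end
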